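import Summits.BirchSwinnertonDyer.Rank1Residual.Additive.QuadraticBranchLower
import Summits.BirchSwinnertonDyer.Rank1Residual.Additive.ChiBranchLowerInputOdd
import Summits.BirchSwinnertonDyer.Rank1Residual.AdditivePotMult.PotMultChiBranchPrimePrep
import HarnessLib

/-!
# Descent of the quadratic-branch conjecture to the `T = 0` inputs on the WHOLE semistable-twist
# locus — good ordinary AND multiplicative `E♭` (the (M) rows) — both parities
# (cell `b2b-bsdres`, team n1011, seat p10; sequel of `QuadraticBranchLowerDescent.lean`, written on
# seat p07's request of 2026-08-21T05:51Z)

HONEST FRAMING (cell `b2b-bsdres`, run/shared/lean/b2b/bsd-rank1-residual/, verbatim in every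
file): the goal of the cell is to DELETE the COMBINATION-SHAPED residual classes of the
Birch–Swinnerton-Dyer formula for ALL analytic-rank `≤ 1` elliptic curves over `ℚ` — "full BSD
formula for every rank `≤ 1` curve in class `C`" assembled STRICTLY from published theorems — so
that the rank-`≤ 1` remainder becomes exactly the CONSTRUCTION-SHAPED classes, which are TYPED
(missing-input `Prop`s), NOT attempted. This is not "finishing BSD". Team n1011 (N10/N11): research
route; N10/N11 stay CONSTRUCTION; nothing booked; no label moves. Theorems only (no definition, no
named fact): compositions of the cell's kernel descent with OUR conjecture
`QuadraticBranchLowerDivisibilityAt` (`@[conjecture] def`, NOT in print, nothing asserted) taken as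
an explicit hypothesis.

## What this file proves

`QuadraticBranchLowerDescent.lean` reaches seat p07's `T = 0` inputs `ChiBranchLowerLeadingTerm[Odd]At W p`
only on a potentially GOOD `W` (`0 ≤ ord_p j`), because it runs through the Λ-adic `W`-level input,
typed for a good ordinary twist. Here the `T = 0` inputs are derived DIRECTLY from the `E♭`-level
conjecture for EVERY semistable twist datum `V` — good ordinary (branch `L_p(f, α, ω^m, ·)`,
`B(0) = α⁻¹∑(a/p)[a/p]^±`, tree `constantCoeff_padicLFunction[Minus]Branch_half`) OR multiplicative
(branch with `a_p = ±1`, `B(0) = ±∑(a/p)[a/p]^±`, additive-p1's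
`AdditivePotMult.exists_halfBranchMult_even/odd` over additive-p4's
`constantCoeff_padicLFunction{Plus,Minus}BranchMult_half`) — so with NO hypothesis on `ord_p j(W)`:

* `chiBranchLowerLeadingTermAt_of_quadraticBranchLower` (`p ≡ 1 (mod 4)`),
* `chiBranchLowerLeadingTermOddAt_of_quadraticBranchLower` (`p ≡ 3 (mod 4)`, `p = 3` included).

Downstream (seat p07, `ChiBranchLowerTransportPotMult.lean` / `ChiBranchLowerTransportGord.lean`):
`ClassX4M/ClassX3M/ClassX4Gord.missingLowerBoundAt_rankZero_of_chiBranchLower[Odd]…` — so on the (M)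
rows (82 103 of the 117 893 N11 cells) the Miller-currency LOWER half now follows from OUR `E♭`-level
conjecture by modus ponens. Nothing booked.

References: Greenberg 1999 [GreenbergLNM1716] §5; Mazur–Tate–Teitelbaum 1986
[MazurTateTeitelbaum1986Invent] §I.10, §I.13–I.14; Skinner–Urban 2014 [SkinnerUrban2014] Thm. 3.6.4
(shape only).
-/

noncomputable section

open scoped Classical MatrixGroups ModularForm

open CongruenceSubgroup WeierstrassCurve Literature.NumberTheory.EllipticCurves
  Literature.NumberTheory.EllipticCurves.ModularForms
  Literature.NumberTheory.EllipticCurves.Rank1Residual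
  Literature.NumberTheory.GaloisRepresentations

namespace Summit.BirchSwinnertonDyer.Rank1Residual.Additive

variable (W : WeierstrassCurve ℚ) (p : ℕ) [hp : Fact p.Prime]

/-- **`T = 0`, EVEN branch, every semistable twist datum: OUR conjecture ⟹
`ChiBranchLowerLeadingTermAt W p`.** For a datum `C • V^{(p)} = W` with `V` good ordinary OR
multiplicative at `p`: descend a `Λ`-dual datum of `Sel_{p^∞}(W/ℚ_∞)` to the eigen-datum over
`ℚ(μ_{p^∞})` (`SelmerDualData.exists_chiEigenInCyclotomic`, same `char`), apply the conjecture with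
the branch `B` of `V`'s reduction type, and read the constant term (`α⁻¹∑(a/p)[a/p]⁺`, resp.
`±∑(a/p)[a/p]⁺`). [cite: MazurTateTeitelbaum1986Invent, §I.10, §I.13–I.14] [cite: GreenbergLNM1716, §5 (PDF p. 143)] -/
theorem chiBranchLowerLeadingTermAt_of_quadraticBranchLower
    (hc : ∀ (V : WeierstrassCurve ℚ) [V.IsElliptic] [V.IsGloballyMinimal],
      (∃ C : VariableChange ℚ, C • V.quadraticTwist ((-1) ^ (p / 2) * p : ℚ) = W) →
        QuadraticBranchLowerDivisibilityAt V p) :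
    ChiBranchLowerLeadingTermAt W p := by
  intro V _ _ κ γ N _ f hp1 hCW hred hκ hγ hcv hf D ϖ hϖ g hg
  have hp2 : p ≠ 2 := by rintro rfl; norm_num at hp1
  have hpne : (p : ℚ) ≠ 0 := Nat.cast_ne_zero.mpr hp.out.ne_zero
  have heven : Even (p / 2) := ⟨p / 4, by omega⟩
  obtain ⟨C, hC⟩ := hCW
  have hcV : QuadraticBranchLowerDivisibilityAt V p :=
    hc V ⟨C, by rw [pStar_eq_self_of_mod_four_eq_one hp1]; exact hC⟩
  haveI hcycL : IsCyclotomicExtension {p} ℚ (CyclotomicField p ℚ) := by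
    have h : (CyclotomicField.algebra p ℚ : Algebra ℚ (CyclotomicField p ℚ)) =
        DivisionRing.toRatAlgebra := Subsingleton.elim _ _
    exact h ▸ CyclotomicField.isCyclotomicExtension p ℚ
  obtain ⟨K, θ, hK2, hθ, hθ2⟩ := exists_intermediateField_sq_eq_pStar p (CyclotomicField p ℚ) hp2
  haveI : NumberField K := NumberField.of_module_finite ℚ K
  have hcK : θ ^ 2 = algebraMap ℚ K (p : ℚ) := by
    rw [hθ2, pStar_eq_self_of_mod_four_eq_one hp1]
  haveI : IsGalois ℚ K := isGalois_of_finrank_eq_two K hK2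
  haveI := normal_galRange K hK2 (sigmaQ_ne_one K hK2 hθ hcK)
  haveI := normal_galRange_cyclotomic p (CyclotomicField p ℚ)
  haveI : (V.quadraticTwist (p : ℚ)).IsElliptic := V.isElliptic_quadraticTwist hpne
  obtain ⟨γ', hγ'KF, hκγ', ⟨g₀, hg₀, hγ'eq⟩, D', hchar, -⟩ :=
    SelmerDualData.exists_chiEigenInCyclotomic p (CyclotomicField p ℚ) V K hK2 hθ hcK κ hC hp2 D
  have hg' : g ∈ Literature.NumberTheory.EllipticCurves.Module.charIdeal (IwasawaAlgebra p) D'.X := by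
    rw [hchar]; exact hg
  rcases hred with hord | hmult
  · -- good ordinary twist: the unit-root branch
    obtain ⟨h, hιg⟩ := hcV K (CyclotomicField p ℚ) (κ := κ) (γ := γ') (f := f)
      (padicLFunctionBranch f ((unitRoot V p : ℤ_[p]) : ℚ_[p]) (p / 2)) hp2 hK2 ⟨θ, hθ2⟩
      (Or.inl ⟨hord, by rw [if_pos heven]⟩) hκ (isTopGenerator_of_kappa_eq κ hκγ' hγ)
      (isCyclotomicVariable_of_eq_mul p κ hκ hg₀ hγ'eq hcv)
      (Subgroup.mem_inf.mp hγ'KF).1 (Subgroup.mem_inf.mp hγ'KF).2 hf D' ϖ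
      (by rw [if_pos heven]; exact hϖ) g hg'
    exact exists_padicInt_constantCoeff_eq_of_iwasawaToPowerSeries_eq_mul_branch p hp2 V hord hf hιg
  · -- multiplicative twist: the `a_p = ±1` branch
    obtain ⟨B, e, hB, hB0⟩ := AdditivePotMult.exists_halfBranchMult_even p hp2 heven hmult hf
    obtain ⟨h, hιg⟩ := hcV K (CyclotomicField p ℚ) (κ := κ) (γ := γ') (f := f) B hp2 hK2 ⟨θ, hθ2⟩
      hB hκ (isTopGenerator_of_kappa_eq κ hκγ' hγ) (isCyclotomicVariable_of_eq_mul p κ hκ hg₀ hγ'eq hcv)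
      (Subgroup.mem_inf.mp hγ'KF).1 (Subgroup.mem_inf.mp hγ'KF).2 hf D' ϖ
      (by rw [if_pos heven]; exact hϖ) g hg'
    refine ⟨PowerSeries.constantCoeff h * (e : ℤ_[p]), ?_⟩
    have h0 := congrArg PowerSeries.constantCoeff hιg
    rw [constantCoeff_iwasawaToPowerSeries, map_mul, map_mul, constantCoeff_iwasawaToPowerSeries,
      PowerSeries.constantCoeff_C, hB0] at h0
    rw [h0, PadicInt.coe_mul]
    ring

/-- **`T = 0`, ODD branch (`p ≡ 3 (mod 4)`, `p = 3` included), every semistable twist datum: OUR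
conjecture ⟹ `ChiBranchLowerLeadingTermOddAt W p`.** Minus branch / minus period; good ordinary
(`constantCoeff_padicLFunctionMinusBranch_half` via seat p07's
`exists_padicInt_constantCoeff_eq_of_iwasawaToPowerSeries_eq_mul_minusBranch`) or multiplicative
(`AdditivePotMult.exists_halfBranchMult_odd`). [cite: MazurTateTeitelbaum1986Invent, §I.10, §I.13–I.14]
[cite: GreenbergLNM1716, §5 (PDF p. 143)] -/
theorem chiBranchLowerLeadingTermOddAt_of_quadraticBranchLower
    (hc : ∀ (V : WeierstrassCurve ℚ) [V.IsElliptic] [V.IsGloballyMinimal],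
      (∃ C : VariableChange ℚ, C • V.quadraticTwist ((-1) ^ (p / 2) * p : ℚ) = W) →
        QuadraticBranchLowerDivisibilityAt V p) :
    ChiBranchLowerLeadingTermOddAt W p := by
  intro V _ _ κ γ N _ f hp3 hCW hred hκ hγ hcv hf D ϖ hϖ g hg
  have hp2 : p ≠ 2 := by rintro rfl; norm_num at hp3
  have hpne : (-(p : ℚ)) ≠ 0 := neg_ne_zero.mpr (Nat.cast_ne_zero.mpr hp.out.ne_zero)
  have hodd : ¬ Even (p / 2) := by rw [Nat.not_even_iff_odd]; exact ⟨p / 4, by omega⟩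
  obtain ⟨C, hC⟩ := hCW
  have hcV : QuadraticBranchLowerDivisibilityAt V p :=
    hc V ⟨C, by rw [pStar_eq_neg_of_mod_four_eq_three hp3]; exact hC⟩
  haveI hcycL : IsCyclotomicExtension {p} ℚ (CyclotomicField p ℚ) := by
    have h : (CyclotomicField.algebra p ℚ : Algebra ℚ (CyclotomicField p ℚ)) =
        DivisionRing.toRatAlgebra := Subsingleton.elim _ _
    exact h ▸ CyclotomicField.isCyclotomicExtension p ℚ
  obtain ⟨K, θ, hK2, hθ, hθ2⟩ := exists_intermediateField_sq_eq_pStar p (CyclotomicField p ℚ) hp2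
  haveI : NumberField K := NumberField.of_module_finite ℚ K
  have hcK : θ ^ 2 = algebraMap ℚ K (-(p : ℚ)) := by
    rw [hθ2, pStar_eq_neg_of_mod_four_eq_three hp3]
  haveI : IsGalois ℚ K := isGalois_of_finrank_eq_two K hK2
  haveI := normal_galRange K hK2 (sigmaQ_ne_one K hK2 hθ hcK)
  haveI := normal_galRange_cyclotomic p (CyclotomicField p ℚ)
  haveI : (V.quadraticTwist (-(p : ℚ))).IsElliptic := V.isElliptic_quadraticTwist hpne
  obtain ⟨γ', hγ'KF, hκγ', ⟨g₀, hg₀, hγ'eq⟩, D', hchar, -⟩ :=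
    SelmerDualData.exists_chiEigenInCyclotomic p (CyclotomicField p ℚ) V K hK2 hθ hcK κ hC hp2 D
  have hg' : g ∈ Literature.NumberTheory.EllipticCurves.Module.charIdeal (IwasawaAlgebra p) D'.X := by
    rw [hchar]; exact hg
  rcases hred with hord | hmult
  · obtain ⟨h, hιg⟩ := hcV K (CyclotomicField p ℚ) (κ := κ) (γ := γ') (f := f)
      (padicLFunctionMinusBranch f ((unitRoot V p : ℤ_[p]) : ℚ_[p]) (p / 2)) hp2 hK2 ⟨θ, hθ2⟩
      (Or.inl ⟨hord, by rw [if_neg hodd]⟩) hκ (isTopGenerator_of_kappa_eq κ hκγ' hγ)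
      (isCyclotomicVariable_of_eq_mul p κ hκ hg₀ hγ'eq hcv)
      (Subgroup.mem_inf.mp hγ'KF).1 (Subgroup.mem_inf.mp hγ'KF).2 hf D' ϖ
      (by rw [if_neg hodd]; exact hϖ) g hg'
    exact exists_padicInt_constantCoeff_eq_of_iwasawaToPowerSeries_eq_mul_minusBranch p hp2 V hord hf
      hιg
  · obtain ⟨B, e, hB, hB0⟩ := AdditivePotMult.exists_halfBranchMult_odd p hp2 hodd hmult hf
    obtain ⟨h, hιg⟩ := hcV K (CyclotomicField p ℚ) (κ := κ) (γ := γ') (f := f) B hp2 hK2 ⟨θ, hθ2⟩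
      hB hκ (isTopGenerator_of_kappa_eq κ hκγ' hγ) (isCyclotomicVariable_of_eq_mul p κ hκ hg₀ hγ'eq hcv)
      (Subgroup.mem_inf.mp hγ'KF).1 (Subgroup.mem_inf.mp hγ'KF).2 hf D' ϖ
      (by rw [if_neg hodd]; exact hϖ) g hg'
    refine ⟨PowerSeries.constantCoeff h * (e : ℤ_[p]), ?_⟩
    have h0 := congrArg PowerSeries.constantCoeff hιg
    rw [constantCoeff_iwasawaToPowerSeries, map_mul, map_mul, constantCoeff_iwasawaToPowerSeries,
      PowerSeries.constantCoeff_C, hB0] at h0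
    rw [h0, PadicInt.coe_mul]
    ring

end Summit.BirchSwinnertonDyer.Rank1Residual.Additive

end
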